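import Literature.MathematicalPhysics.QuantumFieldTheory.Balaban1983to89.B9Thm311SmallFieldCoercivityTowerTwoWindows
import Literature.MathematicalPhysics.QuantumFieldTheory.Balaban1983to89.B9Eq334LaplaceAkCovariance
import Literature.MathematicalPhysics.QuantumFieldTheory.Balaban1983to89.B9Eq3126GreenLetters

/-!
# `Balaban1983to89.B9Thm311TowerGaugeOrbitTwoWindows` — T. Bałaban, *Propagators for lattice gauge theories in a background field*, Commun. Math. Phys. **99**
# (1985) 389–434 [Balaban1985BackgroundPropagators] Thm 3.11 p. 416, Thm 3.4 p. 400, (3.34)–(3.35) p. 396; [Balaban1985Averaging] Prop. 2 (52)–(54) p. 26: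
# **[B9] THM 3.11 AT `k` LEVELS ON PRINT's CLASS (3.35) OF THE ONE-CUBE TORUS** — the two-window theorems of `B9Thm311SmallFieldCoercivityTowerTwoWindows`
# (coercivity of `Δ^{(n+1)}_a`, `‖G_k‖ ≤ γ₁⁻¹`, positive definiteness; `∃ α₀ γ₁` BEFORE every binder) CARRIED ALONG THE GAUGE ORBIT WITH THE SAME CONSTANTS:
# for `U` with bonds `αη`-close and plaquettes `αη²`-close to `1` (print's two displays of (3.35), read on the torus) and ANY unitary-type gauge `u`, the
# conclusions hold for `U^u` — (3.35) verbatim for □ = the torus: *«there exists a gauge transformation u on □ such that U^u = e^{iηA}, |A| < …, |∇^η A| < …»*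

statement-level skeleton of published theorems with citation tags; proofs where landed; nothing here is a claim about the Yang–Mills mass gap

CITATION HEADER (lean-in-tree rule).  Audit cell `pub-balaban`, sub-cell `t4`, BINDER row NE9; filed by NE9 formalisation-swarm leaf prover 03
(`b2b-balaban-t4-ne9-formalise-leaf-03`, gen 65), INTENT I-ne9leaf03-g65-4 — the k-level twin of `B9Thm311GaugeOrbitClosed` (one step) over this lineage's
INTENT-2 (`…TowerTwoWindows`) and INTENT-3 (`B9Eq334LaplaceAkCovariance`, (3.34) one storey up).  Sources READ in the held text
`paper:balaban1985-cmp99-background-propagators` (journal page = PDF page + 388): pp. 396, 400, 416.  Objects BY NAME: the owner's `laplaceAk` (with E162's data as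
arguments), `G1LatticeK`; the chain's `gaugeU`, `gaugeW`, `AdW`, `AdA`; nothing re-declared, 0 `def`.

THE PRINT (verbatim).  p. 416 Thm 3.11: *«Under the assumptions of the Theorems 3.1–3.10 (i.e. for M sufficiently large and α₀ sufficiently small) the operators
Δ′_a, G′, (Q′G′²Q′*)⁻¹, Δ_a, G are positive definite.»*; p. 396 (3.35): *«for a configuration U there exists a gauge transformation u on □ such that U^u = e^{iηA}
and … |A| < O(1)Mα₀(L^jη)⁻¹, |∇^η_U A| < O(1)Mα₀(L^jη)⁻² on □»*; (3.34): *«Δ_a(U^u) = R(u)Δ_a(U)R(u⁻¹), G(U^u) = R(u)G(U)R(u⁻¹)»*.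

WHAT IS PROVED (sorry-free; proof lane — 0 `def`; [folklore] ∃-plumbing of INTENT-2 through INTENT-3's form invariance).
* §1 `coercive_laplaceAk_gaugeU` — a mass-row coercivity bound for `Δ^{(n+1)}_a(U)` holds for `Δ^{(n+1)}_a(U^u)` with the SAME constant (form and norm invariant);
  `norm_G1k_le_gaugeU` — hence `‖G_k(U^u)y‖ ≤ γ⁻¹‖y‖` at any positivity witness (`B9Eq3126GreenLetters.norm_greenK_le`).
* §2 **`exists_coercive_laplaceAk_gaugeOrbit_twoWindows`** — `∃ α₀ γ₁ > 0` (the two-window constants, `α₀` cut to the class thresholds) such that for every `n`, `η`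
  (`ηL^{n+1} = 1`), `c₀(L^{n+1})^d = c₁`, `|η|^d∕c₀ ≤ ρ_w`, `m`, `U : Bond(T_{L^{n+1}m}) → S` (`S ≤ U1` averaging-closed) with E162's data and `hRS`, `0 ≤ α ≤ α₀`,
  `‖U(b) − 1‖ ≤ αη`, `‖U(∂p) − 1‖ ≤ αη²`, and EVERY `S`-valued gauge `u` (`u(x)* = u(x)⁻¹`, `τ`-central, fibrewise isometric) with ANY E162 data for `U^u`:
  `γ₁‖x‖² ≤ re⟨x, Δ^{(n+1)}_a(U^u)x⟩`; **`exists_laplaceAk_pos_gaugeOrbit_twoWindows`** (Thm 3.11 «Δ_a positive definite» on the orbit);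
  **`exists_norm_G1k_le_gaugeOrbit_twoWindows`** (Thm 3.4's `L²` clause `‖G_k(U^u)y‖ ≤ γ₁⁻¹‖y‖` on the orbit, any positivity witness).
WHAT THIS IS AND IS NOT.  The hypothesis «`U^u` for some `u`, `U` two-window-small» IS print's (3.35) when the cube □ is the whole torus (one cube); it is NOT the
per-cube statement for `M`-cubes of a large torus (the IMS ∕ localisation road, ROUTES-NE9 R2′ B8′), and on the torus the orbit of the two-window set is a PROPER
subset of the plaquette class (non-contractible holonomies, `B7Eq45TorusGaugeOrbit`).  No decay, no infinite volume.
HONEST SCOPE.  [folklore]; «NE9 ⇐ the named binders»; NE9 NOT PRINTED ∕ NOT PROVED; NOT summit progress (cell pub-balaban: row NE9 WALLED ON A MODEL; spine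
PROVED 0/9; rung (B)+1 finite T⁴ — NOT infinite volume, NOT mass gap, NOT Clay; HONEST DEPENDENCY: continuum YM on T⁴ ⇐ BetaPertH ∧ nine spine estimates (0/9
proved); BetaPertH ⇐ (D1) ∧ (D4) ∧ CAP+tail; G-an2-4 gates asym, D1 and NE2/3/4).  NEW file; modifies nothing.  Net new unproved facts: 0.
-/

noncomputable section

open scoped InnerProductSpace ComplexConjugate BigOperators

namespace Literature.MathematicalPhysics.QuantumFieldTheory.Balaban1983to89.B9Thm311TowerGaugeOrbitTwoWindows

open B4Sect5Torus (TSite)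
open B9SectCLatticeCarrier (Bond bpos)
open B11Eq103H1Complex (BondL2K G1LatticeK)
open B9Eq310HessianOperator (adTransportW)
open B9Eq310DeltaPrime (plaqHolU)
open B9Eq315QTorus (perCfg cornerSite)
open B9Eq315QTorusOnto (liftSite)
open B9Eq315QTower (towerP UlevOf)
open B9Eq326OperatorTower (laplaceAk)
open B7Prop1Explicit (U1 Wcx boxVec)
open B7Prop2Explicit (pdev C0 c2' AvgClosed C0_pos c2'_pos)
open B7AvgGaugeCovariance (pdev_gaugeAct)
open B9Eq328GaugeAction (gaugeU AdA AdW gaugeW gaugeW_apply_inv inner_gaugeW norm_gaugeW)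
open B9Eq3126GreenLetters (norm_greenK_le)
open B7Eq43AveragedSmallnessLevelFree (pdev_perCfg_le_of_plaq)
open B9Eq334LaplaceAkCovariance (inner_laplaceAk_gaugeU)
open B9Thm311SmallFieldCoercivityTowerTwoWindows (exists_coercive_laplaceAk_diagonal_twoWindows)

variable {d : ℕ} (L : ℕ) [NeZero L] (hL : 1 ≤ L) (hL2 : 2 ≤ L)
  {𝔸 : Type*} [NormedRing 𝔸] [NormedAlgebra ℂ 𝔸] [CompleteSpace 𝔸] [NormOneClass 𝔸] [StarRing 𝔸] [NormedStarGroup 𝔸] [StarModule ℂ 𝔸]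
  {W : Type*} [NormedAddCommGroup W] [InnerProductSpace ℂ W] [FiniteDimensional ℂ W] (φ : W ≃ₗ[ℂ] 𝔸) {c₀ c₁ : ℝ} (τ : 𝔸 →ₗ[ℂ] ℂ) (η : ℝ)

/-! ## §1 Coercivity and the `G_k`-bound pass to `U^u` with the same constant -/

section Transfer

variable [Fact (0 < c₀)] [Fact (0 < c₁)] (m : Fin d → ℕ) [∀ i, NeZero (m i)] (n : ℕ) {S : Subgroup 𝔸ˣ} (hS : AvgClosed d L S)
  (U : Bond d (towerP L m (n + 1)) → 𝔸ˣ) (hU : ∀ b, U b ∈ S) (g : TSite d (towerP L m (n + 1)) → 𝔸ˣ) (hg : ∀ x, g x ∈ S)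
  {α₀ : ℝ} (hα : 0 < α₀) (hα3 : C0 d * α₀ ≤ 1 / 3) (hα2 : 2 * α₀ ≤ c2' d L)
  (h52 : pdev (perCfg (towerP L m (n + 1)) U) < α₀ * (((L : ℝ) ^ (n + 1))⁻¹) ^ 2)
  (αU : ℕ → ℝ) (hα1 : ∀ j, αU j ≤ 1 / 64)
  (hU1 : ∀ (j : ℕ) (x : B7Prop1Explicit.Site d) (κ : Fin d), perCfg (towerP L m (j + 1)) (UlevOf L m (n + 1) U j) x κ ∈ U1 𝔸)
  (hreg : ∀ (j : ℕ) (y : TSite d (towerP L m j)) (κ : Fin d) (r : Fin d → Fin L),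
    ‖((Wcx L (perCfg (towerP L m (j + 1)) (UlevOf L m (n + 1) U j)) (cornerSite L y) κ (boxVec L r) : 𝔸ˣ) : 𝔸) - 1‖ ≤ αU j)
  (hU1' : ∀ (j : ℕ) (x : B7Prop1Explicit.Site d) (κ : Fin d), perCfg (towerP L m (j + 1)) (UlevOf L m (n + 1) (gaugeU g U) j) x κ ∈ U1 𝔸)
  (hreg' : ∀ (j : ℕ) (y : TSite d (towerP L m j)) (κ : Fin d) (r : Fin d → Fin L),
    ‖((Wcx L (perCfg (towerP L m (j + 1)) (UlevOf L m (n + 1) (gaugeU g U) j)) (cornerSite L y) κ (boxVec L r) : 𝔸ˣ) : 𝔸) - 1‖ ≤ αU j)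
  (hτ : ∀ (x : TSite d (towerP L m (n + 1))) (X : 𝔸), τ (AdA (g x) X) = τ X) (hstar : ∀ x, star (g x : 𝔸) = ((g x)⁻¹ : 𝔸ˣ))
  (hAd : ∀ (x : TSite d (towerP L m (n + 1))) (v v' : W), ⟪AdW φ (g x) v, AdW φ (g x) v'⟫_ℂ = ⟪v, v'⟫_ℂ)

omit [NormedStarGroup 𝔸] in
include hL2 hS hU hg hα hα3 hα2 h52 hU1 hreg hτ hstar hAd in
/-- **A mass-row coercivity bound for `Δ^{(n+1)}_a(U)` holds for `Δ^{(n+1)}_a(U^u)` with the SAME constant**: the form ((3.34), `inner_laplaceAk_gaugeU`) and the norm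
(`R(u)` unitary) are both invariant. [cite: Balaban1985BackgroundPropagators, Thm 3.11 p.416, (3.34) p.396] -/
theorem coercive_laplaceAk_gaugeU (a : ℝ) {γ : ℝ}
    (hcoer : ∀ x : BondL2K ℂ d (towerP L m (n + 1)) c₀ W,
      γ * ‖x‖ ^ 2 ≤ RCLike.re ⟪x, laplaceAk L m n φ η U hL αU hα1 hU1 hreg τ (c₀ := c₀) (c₁ := c₁) a x⟫_ℂ)
    (x : BondL2K ℂ d (towerP L m (n + 1)) c₀ W) :
    γ * ‖x‖ ^ 2 ≤ RCLike.re ⟪x, laplaceAk L m n φ η (gaugeU g U) hL αU hα1 hU1' hreg' τ (c₀ := c₀) (c₁ := c₁) a x⟫_ℂ := by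
  obtain ⟨y, rfl⟩ : ∃ y, gaugeW φ (fun b : Bond d (towerP L m (n + 1)) => g (bpos b)) y = x := ⟨_, gaugeW_apply_inv φ _ x⟩
  rw [inner_laplaceAk_gaugeU L m n hL hL2 hS U hU g hg hα hα3 hα2 h52 φ τ η αU hα1 hU1 hreg hU1' hreg' hτ hstar hAd,
    norm_gaugeW φ (w := fun _ : Bond d (towerP L m (n + 1)) => c₀) _ fun b => hAd (bpos b)]
  exact hcoer y

omit [NormedStarGroup 𝔸] in
include hL2 hS hU hg hα hα3 hα2 h52 hU1 hreg hτ hstar hAd in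
/-- … hence `‖G_k(U^u)y‖ ≤ γ⁻¹‖y‖` for any positivity witness at `U^u` (`B9Eq3126GreenLetters.norm_greenK_le`).
[cite: Balaban1985BackgroundPropagators, Thm 3.4 p.400, Thm 3.11 p.416, (3.34) p.396] -/
theorem norm_G1k_le_gaugeU (a : ℝ) {γ : ℝ} (hγ : 0 < γ)
    (hcoer : ∀ x : BondL2K ℂ d (towerP L m (n + 1)) c₀ W,
      γ * ‖x‖ ^ 2 ≤ RCLike.re ⟪x, laplaceAk L m n φ η U hL αU hα1 hU1 hreg τ (c₀ := c₀) (c₁ := c₁) a x⟫_ℂ)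
    (hpos' : ∀ x : BondL2K ℂ d (towerP L m (n + 1)) c₀ W, x ≠ 0 →
      0 < RCLike.re ⟪x, laplaceAk L m n φ η (gaugeU g U) hL αU hα1 hU1' hreg' τ (c₀ := c₀) (c₁ := c₁) a x⟫_ℂ)
    (y : BondL2K ℂ d (towerP L m (n + 1)) c₀ W) : ‖G1LatticeK hpos' y‖ ≤ γ⁻¹ * ‖y‖ :=
  norm_greenK_le hγ (coercive_laplaceAk_gaugeU L hL hL2 φ τ η m n hS U hU g hg hα hα3 hα2 h52 αU hα1 hU1 hreg hU1' hreg' hτ hstar hAd a hcoer) hpos' y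

end Transfer

/-! ## §2 [B9] Thm 3.11 at `k` levels on print's class (3.35) of the one-cube torus -/

section Orbit

variable [Fact (0 < c₀)] [Fact (0 < c₁)]

omit [NeZero L] [Fact (0 < c₀)] [Fact (0 < c₁)] in
include hL2 in
/-- The class thresholds below an owner constant: `∃ T > 0, T ≤ α₁ ∧ C₀(2T) ≤ ⅓ ∧ 4T ≤ c₂′`. [folklore] -/
private theorem thresholds' {α₁ : ℝ} (hα₁ : 0 < α₁) :
    ∃ T : ℝ, 0 < T ∧ T ≤ α₁ ∧ C0 d * (2 * T) ≤ 1 / 3 ∧ 2 * (2 * T) ≤ c2' d L := by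
  have hC0 := C0_pos d
  have hc2 := c2'_pos d L (le_trans (by norm_num) hL2)
  refine ⟨min α₁ (min (1 / (6 * C0 d)) (c2' d L / 4)), lt_min hα₁ (lt_min (by positivity) (by positivity)), min_le_left _ _, ?_, ?_⟩
  · have hA3 : min α₁ (min (1 / (6 * C0 d)) (c2' d L / 4)) ≤ 1 / (6 * C0 d) := (min_le_right _ _).trans (min_le_left _ _)
    have h := mul_le_mul_of_nonneg_left hA3 hC0.le
    rw [mul_one_div, show C0 d / (6 * C0 d) = 1 / 6 by field_simp] at h
    linarith
  · have hA2 : min α₁ (min (1 / (6 * C0 d)) (c2' d L / 4)) ≤ c2' d L / 4 := (min_le_right _ _).trans (min_le_right _ _)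
    linarith

omit [Fact (0 < c₀)] [Fact (0 < c₁)] [StarRing 𝔸] [NormedStarGroup 𝔸] [StarModule ℂ 𝔸] in
/-- From the two windows at `α ≤ T` to print's class (52) for the periodic extension at the constant `2T`. [folklore]
[cite: Balaban1985Averaging, (44) p.24, Prop. 2 (52) p.26] -/
private theorem class_of_windows (m : Fin d → ℕ) [∀ i, NeZero (m i)] (n : ℕ) {S : Subgroup 𝔸ˣ} (hS : AvgClosed d L S)
    {U : Bond d (towerP L m (n + 1)) → 𝔸ˣ} (hU : ∀ b, U b ∈ S) {T α η : ℝ} (hT0 : 0 < T) (hηL : η * (L : ℝ) ^ (n + 1) = 1) (hα0 : 0 ≤ α) (hαle : α ≤ T)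
    (hpl : ∀ p : B9SectCLatticeCarrier.Plaq d (towerP L m (n + 1)), ‖(plaqHolU U p : 𝔸) - 1‖ ≤ α * η ^ 2) :
    pdev (perCfg (towerP L m (n + 1)) U) < (2 * T) * (((L : ℝ) ^ (n + 1))⁻¹) ^ 2 := by
  have hη : η = ((L : ℝ) ^ (n + 1))⁻¹ := (inv_eq_of_mul_eq_one_left hηL).symm
  have hL0 : (0 : ℝ) < (L : ℝ) ^ (n + 1) := by
    have h1 : η * (L : ℝ) ^ (n + 1) ≠ 0 := by rw [hηL]; exact one_ne_zero
    rcases lt_trichotomy ((L : ℝ) ^ (n + 1)) 0 with h | h | h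
    · exact absurd h (not_lt.2 (pow_nonneg (Nat.cast_nonneg L) _))
    · exact absurd (by rw [h, mul_zero]) h1
    · exact h
  have hpd : pdev (perCfg (towerP L m (n + 1)) U) ≤ α * η ^ 2 := pdev_perCfg_le_of_plaq (fun b => hS.le_U1 (hU b)) (by positivity) hpl
  refine lt_of_le_of_lt hpd ?_
  rw [hη]
  exact mul_lt_mul_of_pos_right (by linarith) (by positivity)

variable {Mφ Mφ' : ℝ} (hMφ : 0 ≤ Mφ) (hMφ' : 0 ≤ Mφ') (hφ : ∀ w, ‖φ w‖ ≤ Mφ * ‖w‖) (hφ' : ∀ X, ‖φ.symm X‖ ≤ Mφ' * ‖X‖) {a : ℝ} (ha : 0 < a)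
  {Cτ : ℝ} (hτC : ∀ X, ‖τ X‖ ≤ Cτ * ‖X‖) (hCτ : 0 ≤ Cτ) {ρw : ℝ} (hρw : 0 ≤ ρw)

include hL2 hMφ hMφ' hφ hφ' ha hτC hCτ hρw

/-- **[B9] THM 3.11 (COERCIVE FORM) AT `k` LEVELS ON THE GAUGE ORBIT OF THE TWO-WINDOW SET — PRINT's CLASS (3.35) OF THE ONE-CUBE TORUS.**  There are
`α₀, γ₁ > 0` (closed in `(d, a, L, M_φ, M_φ′, C_τ, ρ_w)`; `γ₁ = γ(d,a)∕4` of the two-window theorem) such that for every `n`, `η` (`ηL^{n+1} = 1`), weights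
(`c₀(L^{n+1})^d = c₁`, `|η|^d∕c₀ ≤ ρ_w`), `m`, background `U : Bond(T_{L^{n+1}m}) → S` (`S ≤ U1` averaging-closed) with E162's data and `hRS`, `0 ≤ α ≤ α₀`,
`‖U(b) − 1‖ ≤ αη`, `‖U(∂p) − 1‖ ≤ αη²`, and EVERY `S`-valued gauge `u` (`u* = u⁻¹`, `τ`-central, fibrewise isometric) with ANY E162 data for `U^u`:
`γ₁‖x‖² ≤ re⟨x, Δ^{(n+1)}_a(U^u)x⟩` — `exists_coercive_laplaceAk_diagonal_twoWindows` carried by `coercive_laplaceAk_gaugeU`.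
[cite: Balaban1985BackgroundPropagators, Thm 3.11 p.416, (3.34)–(3.35) p.396, (3.26) p.395; Balaban1985Averaging, Prop. 2 (52)–(54) p.26] -/
theorem exists_coercive_laplaceAk_gaugeOrbit_twoWindows :
    ∃ α₀ γ₁ : ℝ, 0 < α₀ ∧ 0 < γ₁ ∧ ∀ (n : ℕ) (η : ℝ), η * (L : ℝ) ^ (n + 1) = 1 →
      ∀ (c₀ c₁ : ℝ) [Fact (0 < c₀)] [Fact (0 < c₁)], c₀ * ((L : ℝ) ^ (n + 1)) ^ d = c₁ → |η| ^ d / c₀ ≤ ρw →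
      ∀ (m : Fin d → ℕ) [∀ i, NeZero (m i)] (U : Bond d (towerP L m (n + 1)) → 𝔸ˣ) (αU : ℕ → ℝ) (hα1 : ∀ j, αU j ≤ 1 / 64)
        (hU1 : ∀ (j : ℕ) (x : B7Prop1Explicit.Site d) (κ : Fin d), perCfg (towerP L m (j + 1)) (UlevOf L m (n + 1) U j) x κ ∈ U1 𝔸)
        (hreg : ∀ (j : ℕ) (y : TSite d (towerP L m j)) (κ : Fin d) (r : Fin d → Fin L),
          ‖((Wcx L (perCfg (towerP L m (j + 1)) (UlevOf L m (n + 1) U j)) (cornerSite L y) κ (boxVec L r) : 𝔸ˣ) : 𝔸) - 1‖ ≤ αU j)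
        {S : Subgroup 𝔸ˣ}, AvgClosed d L S → (∀ b, U b ∈ S) →
      ∀ {α : ℝ}, 0 ≤ α → α ≤ α₀ →
        (∀ (b : Bond d (towerP L m (n + 1))) (v u : W), ⟪adTransportW φ U b v, u⟫_ℂ = ⟪v, adTransportW φ (fun b => (U b)⁻¹) b u⟫_ℂ) →
        (∀ b, ‖(U b : 𝔸) - 1‖ ≤ α * η) →
        (∀ p : B9SectCLatticeCarrier.Plaq d (towerP L m (n + 1)), ‖(plaqHolU U p : 𝔸) - 1‖ ≤ α * η ^ 2) →
      ∀ (g : TSite d (towerP L m (n + 1)) → 𝔸ˣ), (∀ x, g x ∈ S) → (∀ x, star (g x : 𝔸) = ((g x)⁻¹ : 𝔸ˣ)) →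
        (∀ (x : TSite d (towerP L m (n + 1))) (X : 𝔸), τ (AdA (g x) X) = τ X) →
        (∀ (x : TSite d (towerP L m (n + 1))) (v v' : W), ⟪AdW φ (g x) v, AdW φ (g x) v'⟫_ℂ = ⟪v, v'⟫_ℂ) →
      ∀ (hU1' : ∀ (j : ℕ) (x : B7Prop1Explicit.Site d) (κ : Fin d), perCfg (towerP L m (j + 1)) (UlevOf L m (n + 1) (gaugeU g U) j) x κ ∈ U1 𝔸)
        (hreg' : ∀ (j : ℕ) (y : TSite d (towerP L m j)) (κ : Fin d) (r : Fin d → Fin L),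
          ‖((Wcx L (perCfg (towerP L m (j + 1)) (UlevOf L m (n + 1) (gaugeU g U) j)) (cornerSite L y) κ (boxVec L r) : 𝔸ˣ) : 𝔸) - 1‖ ≤ αU j)
        (x : BondL2K ℂ d (towerP L m (n + 1)) c₀ W),
          γ₁ * ‖x‖ ^ 2 ≤ RCLike.re ⟪x, laplaceAk L m n φ η (gaugeU g U) hL αU hα1 hU1' hreg' τ (c₀ := c₀) (c₁ := c₁) a x⟫_ℂ := by
  obtain ⟨α₁, γ₁, hα₁, hγ₁, H⟩ := exists_coercive_laplaceAk_diagonal_twoWindows L hL hL2 φ hMφ hMφ' hφ hφ' ha τ hτC hCτ hρw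
  obtain ⟨T, hT0, hTle, hT3, hT2⟩ := thresholds' L hL2 (d := d) hα₁
  refine ⟨T, γ₁, hT0, hγ₁, ?_⟩
  intro n η hηL c₀ c₁ _ _ hw hρ m _ U αU hα1 hU1 hreg S hS hU α hα0 hαle hRS hUη hpl g hg hstar hτg hAd hU1' hreg' x
  have hcoer := H n η hηL c₀ c₁ hw hρ m U αU hα1 hU1 hreg hS hU hα0 (hαle.trans hTle) hRS hUη hpl
  have h52 := class_of_windows L m n hS hU hT0 hηL hα0 hαle hpl
  exact coercive_laplaceAk_gaugeU L hL hL2 φ τ η m n hS U hU g hg (by positivity) hT3 hT2 h52 αU hα1 hU1 hreg hU1' hreg' hτg hstar hAd a hcoer x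

/-- **[B9] THM 3.11 «Δ_a IS POSITIVE DEFINITE» AT `k` LEVELS ON PRINT's CLASS (3.35) OF THE ONE-CUBE TORUS**: `∃ α₀ > 0` before every binder; then for `U`
two-window-small and any `S`-valued unitary-type gauge `u`, `0 < re⟨x, Δ^{(n+1)}_a(U^u)x⟩` for `x ≠ 0` — the displayed `hpos` of the chain's `G1k ∕ H1k ∕ frakGk`
DISCHARGED on the whole class (3.35) of the one-cube torus. [cite: Balaban1985BackgroundPropagators, Thm 3.11 p.416, (3.34)–(3.35) p.396] -/
theorem exists_laplaceAk_pos_gaugeOrbit_twoWindows :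
    ∃ α₀ : ℝ, 0 < α₀ ∧ ∀ (n : ℕ) (η : ℝ), η * (L : ℝ) ^ (n + 1) = 1 →
      ∀ (c₀ c₁ : ℝ) [Fact (0 < c₀)] [Fact (0 < c₁)], c₀ * ((L : ℝ) ^ (n + 1)) ^ d = c₁ → |η| ^ d / c₀ ≤ ρw →
      ∀ (m : Fin d → ℕ) [∀ i, NeZero (m i)] (U : Bond d (towerP L m (n + 1)) → 𝔸ˣ) (αU : ℕ → ℝ) (hα1 : ∀ j, αU j ≤ 1 / 64)
        (hU1 : ∀ (j : ℕ) (x : B7Prop1Explicit.Site d) (κ : Fin d), perCfg (towerP L m (j + 1)) (UlevOf L m (n + 1) U j) x κ ∈ U1 𝔸)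
        (hreg : ∀ (j : ℕ) (y : TSite d (towerP L m j)) (κ : Fin d) (r : Fin d → Fin L),
          ‖((Wcx L (perCfg (towerP L m (j + 1)) (UlevOf L m (n + 1) U j)) (cornerSite L y) κ (boxVec L r) : 𝔸ˣ) : 𝔸) - 1‖ ≤ αU j)
        {S : Subgroup 𝔸ˣ}, AvgClosed d L S → (∀ b, U b ∈ S) →
      ∀ {α : ℝ}, 0 ≤ α → α ≤ α₀ →
        (∀ (b : Bond d (towerP L m (n + 1))) (v u : W), ⟪adTransportW φ U b v, u⟫_ℂ = ⟪v, adTransportW φ (fun b => (U b)⁻¹) b u⟫_ℂ) →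
        (∀ b, ‖(U b : 𝔸) - 1‖ ≤ α * η) →
        (∀ p : B9SectCLatticeCarrier.Plaq d (towerP L m (n + 1)), ‖(plaqHolU U p : 𝔸) - 1‖ ≤ α * η ^ 2) →
      ∀ (g : TSite d (towerP L m (n + 1)) → 𝔸ˣ), (∀ x, g x ∈ S) → (∀ x, star (g x : 𝔸) = ((g x)⁻¹ : 𝔸ˣ)) →
        (∀ (x : TSite d (towerP L m (n + 1))) (X : 𝔸), τ (AdA (g x) X) = τ X) →
        (∀ (x : TSite d (towerP L m (n + 1))) (v v' : W), ⟪AdW φ (g x) v, AdW φ (g x) v'⟫_ℂ = ⟪v, v'⟫_ℂ) →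
      ∀ (hU1' : ∀ (j : ℕ) (x : B7Prop1Explicit.Site d) (κ : Fin d), perCfg (towerP L m (j + 1)) (UlevOf L m (n + 1) (gaugeU g U) j) x κ ∈ U1 𝔸)
        (hreg' : ∀ (j : ℕ) (y : TSite d (towerP L m j)) (κ : Fin d) (r : Fin d → Fin L),
          ‖((Wcx L (perCfg (towerP L m (j + 1)) (UlevOf L m (n + 1) (gaugeU g U) j)) (cornerSite L y) κ (boxVec L r) : 𝔸ˣ) : 𝔸) - 1‖ ≤ αU j)
        (x : BondL2K ℂ d (towerP L m (n + 1)) c₀ W), x ≠ 0 →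
          0 < RCLike.re ⟪x, laplaceAk L m n φ η (gaugeU g U) hL αU hα1 hU1' hreg' τ (c₀ := c₀) (c₁ := c₁) a x⟫_ℂ := by
  obtain ⟨α₀, γ₁, hα₀, hγ₁, H⟩ := exists_coercive_laplaceAk_gaugeOrbit_twoWindows L hL hL2 φ τ hMφ hMφ' hφ hφ' ha hτC hCτ hρw
  refine ⟨α₀, hα₀, ?_⟩
  intro n η' hηL c₀ c₁ _ _ hw hρ m _ U αU hα1 hU1 hreg S hS hU α hα0 hαle hRS hUη hpl g hg hstar hτg hAd hU1' hreg' x hx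
  have h := H n η' hηL c₀ c₁ hw hρ m U αU hα1 hU1 hreg hS hU hα0 hαle hRS hUη hpl g hg hstar hτg hAd hU1' hreg' x
  have hx2 : 0 < ‖x‖ ^ 2 := by positivity
  nlinarith

/-- **`‖G_k(U^u)y‖ ≤ γ₁⁻¹‖y‖` ON THE GAUGE ORBIT OF THE TWO-WINDOW SET — THM 3.4's `L²` CLAUSE ON PRINT's CLASS (3.35) OF THE ONE-CUBE TORUS**, level-free
`γ₁`, for ANY positivity witness at `U^u`. [cite: Balaban1985BackgroundPropagators, Thm 3.4 p.400, Thm 3.11 p.416, (3.34)–(3.35) p.396] -/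
theorem exists_norm_G1k_le_gaugeOrbit_twoWindows :
    ∃ α₀ γ₁ : ℝ, 0 < α₀ ∧ 0 < γ₁ ∧ ∀ (n : ℕ) (η : ℝ), η * (L : ℝ) ^ (n + 1) = 1 →
      ∀ (c₀ c₁ : ℝ) [Fact (0 < c₀)] [Fact (0 < c₁)], c₀ * ((L : ℝ) ^ (n + 1)) ^ d = c₁ → |η| ^ d / c₀ ≤ ρw →
      ∀ (m : Fin d → ℕ) [∀ i, NeZero (m i)] (U : Bond d (towerP L m (n + 1)) → 𝔸ˣ) (αU : ℕ → ℝ) (hα1 : ∀ j, αU j ≤ 1 / 64)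
        (hU1 : ∀ (j : ℕ) (x : B7Prop1Explicit.Site d) (κ : Fin d), perCfg (towerP L m (j + 1)) (UlevOf L m (n + 1) U j) x κ ∈ U1 𝔸)
        (hreg : ∀ (j : ℕ) (y : TSite d (towerP L m j)) (κ : Fin d) (r : Fin d → Fin L),
          ‖((Wcx L (perCfg (towerP L m (j + 1)) (UlevOf L m (n + 1) U j)) (cornerSite L y) κ (boxVec L r) : 𝔸ˣ) : 𝔸) - 1‖ ≤ αU j)
        {S : Subgroup 𝔸ˣ}, AvgClosed d L S → (∀ b, U b ∈ S) →
      ∀ {α : ℝ}, 0 ≤ α → α ≤ α₀ →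
        (∀ (b : Bond d (towerP L m (n + 1))) (v u : W), ⟪adTransportW φ U b v, u⟫_ℂ = ⟪v, adTransportW φ (fun b => (U b)⁻¹) b u⟫_ℂ) →
        (∀ b, ‖(U b : 𝔸) - 1‖ ≤ α * η) →
        (∀ p : B9SectCLatticeCarrier.Plaq d (towerP L m (n + 1)), ‖(plaqHolU U p : 𝔸) - 1‖ ≤ α * η ^ 2) →
      ∀ (g : TSite d (towerP L m (n + 1)) → 𝔸ˣ), (∀ x, g x ∈ S) → (∀ x, star (g x : 𝔸) = ((g x)⁻¹ : 𝔸ˣ)) →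
        (∀ (x : TSite d (towerP L m (n + 1))) (X : 𝔸), τ (AdA (g x) X) = τ X) →
        (∀ (x : TSite d (towerP L m (n + 1))) (v v' : W), ⟪AdW φ (g x) v, AdW φ (g x) v'⟫_ℂ = ⟪v, v'⟫_ℂ) →
      ∀ (hU1' : ∀ (j : ℕ) (x : B7Prop1Explicit.Site d) (κ : Fin d), perCfg (towerP L m (j + 1)) (UlevOf L m (n + 1) (gaugeU g U) j) x κ ∈ U1 𝔸)
        (hreg' : ∀ (j : ℕ) (y : TSite d (towerP L m j)) (κ : Fin d) (r : Fin d → Fin L),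
          ‖((Wcx L (perCfg (towerP L m (j + 1)) (UlevOf L m (n + 1) (gaugeU g U) j)) (cornerSite L y) κ (boxVec L r) : 𝔸ˣ) : 𝔸) - 1‖ ≤ αU j)
        (hpos' : ∀ x : BondL2K ℂ d (towerP L m (n + 1)) c₀ W, x ≠ 0 →
          0 < RCLike.re ⟪x, laplaceAk L m n φ η (gaugeU g U) hL αU hα1 hU1' hreg' τ (c₀ := c₀) (c₁ := c₁) a x⟫_ℂ)
        (y : BondL2K ℂ d (towerP L m (n + 1)) c₀ W), ‖G1LatticeK hpos' y‖ ≤ γ₁⁻¹ * ‖y‖ := by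
  obtain ⟨α₀, γ₁, hα₀, hγ₁, H⟩ := exists_coercive_laplaceAk_gaugeOrbit_twoWindows L hL hL2 φ τ hMφ hMφ' hφ hφ' ha hτC hCτ hρw
  refine ⟨α₀, γ₁, hα₀, hγ₁, ?_⟩
  intro n η' hηL c₀ c₁ _ _ hw hρ m _ U αU hα1 hU1 hreg S hS hU α hα0 hαle hRS hUη hpl g hg hstar hτg hAd hU1' hreg' hpos' y
  exact norm_greenK_le hγ₁ (fun x => H n η' hηL c₀ c₁ hw hρ m U αU hα1 hU1 hreg hS hU hα0 hαle hRS hUη hpl g hg hstar hτg hAd hU1' hreg' x) hpos' y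

end Orbit

end Literature.MathematicalPhysics.QuantumFieldTheory.Balaban1983to89.B9Thm311TowerGaugeOrbitTwoWindows

end
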